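import Summits.ResolutionOfSingularities.ResolutionOfSingularities.Theses.FrobeniusLadder

/-!
# Route FrobeniusLadder — calibration item `CPSpecimenNotFClosed` (stmt-ResolutionOfSingularities-15335)

The Cossart–Piltant specimen (arXiv:1412.0868, Rem. 3.2): over a field `k` of characteristic `p`,
let `A = k[X₀,…,X₄]/(f)` with `f = X₄^p + X₃·X₀^p + X₂·X₁^p`, let `uᵢ` be the image of `Xᵢ` and
`I = (u₀,u₁,u₂,u₃)`. Then the parameter ideal `I` is **not Frobenius closed**:

* `u₄^p ∈ I^[p] = (z^p : z ∈ I)`, because in `A` the relation `f = 0` reads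
  `u₄^p = -(u₃·u₀^p + u₂·u₁^p)` and `u₀^p, u₁^p ∈ I^[p]`;
* `u₄ ∉ I`: the `k`-algebra map `k[X₀,…,X₄] → k[ε]/(ε²)` (dual numbers) sending `X₄ ↦ ε` and the
  other variables to `0` kills `f` (as `ε^p = 0` for `p ≥ 2`), hence factors through `A`; it kills
  `u₀,…,u₃`, hence `I`, but sends `u₄` to `ε ≠ 0`.
-/

-- single-problem summit: the doubled namespace component `ResolutionOfSingularities` is forced
set_option linter.dupNamespace false

namespace Summit.ResolutionOfSingularities.ResolutionOfSingularities.Theorems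

open MvPolynomial

/-- **The Cossart–Piltant specimen is not F-injective at the origin** (item
stmt-ResolutionOfSingularities-15335, route FrobeniusLadder, calibration): in
`A = k[X₀,…,X₄]/(X₄^p + X₃X₀^p + X₂X₁^p)`, `char k = p`, the class `u₄` of `X₄` is not in the
parameter ideal `I = (u₀,u₁,u₂,u₃)` although `u₄^p ∈ I^[p]`. Proof: `u₄^p = -(u₃u₀^p + u₂u₁^p)`;
and evaluation `X₄ ↦ ε`, `Xᵢ ↦ 0 (i < 4)` into the dual numbers `k[ε]` factors through `A`, kills
`I` and maps `u₄` to `ε ≠ 0`. [cite: CossartPiltant2019, Rem. 3.2] -/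
theorem cpSpecimenNotFClosed_proof :
    Summit.ResolutionOfSingularities.ResolutionOfSingularities.Theses.FrobeniusLadder.CPSpecimenNotFClosed := by
  unfold Summit.ResolutionOfSingularities.ResolutionOfSingularities.Theses.FrobeniusLadder.CPSpecimenNotFClosed
  intro p hp k _ _ f A u I
  have hf : f = X 4 ^ p + X 3 * X 0 ^ p + X 2 * X 1 ^ p := rfl
  have hu : ∀ i, u i = Ideal.Quotient.mk (Ideal.span {f}) (X i) := fun _ => rfl
  have hI : I = Ideal.span {u 0, u 1, u 2, u 3} := rfl
  -- the defining relation of `A`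
  have hrel : u 4 ^ p + u 3 * u 0 ^ p + u 2 * u 1 ^ p = 0 := by
    have h : Ideal.Quotient.mk (Ideal.span {f}) (X 4 ^ p + X 3 * X 0 ^ p + X 2 * X 1 ^ p) = 0 :=
      Ideal.Quotient.eq_zero_iff_mem.mpr (Ideal.mem_span_singleton_self f)
    simpa only [map_add, map_mul, map_pow, ← hu] using h
  refine ⟨?_, ?_⟩
  · -- `u 4 ∉ I`: evaluate into the dual numbers `k[ε]`, `X 4 ↦ ε`, `X i ↦ 0` otherwise
    intro h4
    set v : Fin 5 → DualNumber k := Pi.single 4 DualNumber.eps with hv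
    have hε : (DualNumber.eps : DualNumber k) ^ p = 0 :=
      pow_eq_zero_of_le hp.two_le DualNumber.eps_pow_two
    have hvf : (MvPolynomial.aeval v).toRingHom f = 0 := by
      rw [hf]
      simp [hv, hε]
    have hker : ∀ a ∈ Ideal.span {f}, (MvPolynomial.aeval v).toRingHom a = 0 := by
      intro a ha
      obtain ⟨c, rfl⟩ := Ideal.mem_span_singleton'.mp ha
      rw [map_mul, hvf, mul_zero]
    obtain ⟨θ, hθ⟩ :
        ∃ θ : MvPolynomial (Fin 5) k ⧸ Ideal.span {f} →+* DualNumber k, ∀ i, θ (u i) = v i :=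
      ⟨Ideal.Quotient.lift (Ideal.span {f}) (MvPolynomial.aeval v).toRingHom hker, fun i => by
        rw [hu, Ideal.Quotient.lift_mk]
        exact MvPolynomial.aeval_X v i⟩
    have hIle : I ≤ RingHom.ker θ := by
      rw [hI, Ideal.span_le]
      rintro x (rfl | rfl | rfl | rfl) <;> simp [RingHom.mem_ker, hθ, hv]
    have h0 : θ (u 4) = 0 := (RingHom.mem_ker).mp (hIle h4)
    rw [hθ, hv, Pi.single_eq_same] at h0
    have h1 := congrArg TrivSqZeroExt.snd h0
    simp at h1
  · -- `u 4 ^ p ∈ I^[p]`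
    have h0 : u 0 ∈ I := by rw [hI]; exact Ideal.subset_span (by simp)
    have h1 : u 1 ∈ I := by rw [hI]; exact Ideal.subset_span (by simp)
    have heq : u 4 ^ p = -(u 3 * u 0 ^ p + u 2 * u 1 ^ p) := by linear_combination hrel
    rw [heq]
    refine neg_mem (add_mem (Ideal.mul_mem_left _ _ ?_) (Ideal.mul_mem_left _ _ ?_))
    · exact Ideal.subset_span ⟨u 0, h0, rfl⟩
    · exact Ideal.subset_span ⟨u 1, h1, rfl⟩

end Summit.ResolutionOfSingularities.ResolutionOfSingularities.Theorems
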